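/-
Copyright (c) 2026 the pub-hodgecm-mathlib formalisation cell (harness21).  Prover seat hodgecm-mathlib-LH4-p07 (g3), req620 Track A «(D-RAM) FOUR-FRAME» squad
(MS ROAD A, Stage B brick B7 (iv) «CORE-HANGING COUNT», FILE (A); Stage B lead LH4-p10 (g2), dealer LH4-plan (g11)).  2026-09-04.
-/
import Summits.HodgeConjecture.HodgeConjecture.Theorems.F0P3cDyRamDiagonalGluedTorusOrbits        -- ★ (iv-a) LH4-p08 (g2): `mapGL_diagGLUnits_latt_glued`, `v_kappa_sub_le_of_latt_glued_eq`, `latt_glued_kappa_eq_mapGL`, `exists_glued_of_mem_orbit`; brings ★ TorusDefs, ★ HNF(Exists)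
import Summits.HodgeConjecture.HodgeConjecture.Theorems.F0P3cDyRamDiagonalCoreHangingCriterion    -- ★ p855897 B7 (i) (this seat): `isDualisableLattice_latt_hnf_coreHanging_iff` (criterion (R) at `s = 0`)
import HarnessLib

/-!
# Crux `H413`, MS ROAD A, STAGE B brick B7 (iv), FILE (A): the UNIT-TORUS ORBITS of the CORE-HANGING stratum `H(2ρ)` — the invariant `κ = y″∕(xζ)` (a UNIT with `1 + κ` a unit)
# modulo `𝔭^ρ`, representatives with `κ = f` exactly, the orbit `𝒯·latt V_H(1,1,f)`, and dualisability = `F`-rationality of the class of `κ`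

Cell `hodgecm-mathlib` (D-0151), FLOOR 0, crux item H413 = `stmt-HodgeConjecture-24833`; lane `--supports stmt-HodgeConjecture-24833 --as helper` (count-neutral).  THEOREMS ONLY
(no `def`, no instance, no notation, no `sorry`, default heartbeats).  The `s = 0` twin of ★ (iv-a) `F0P3cDyRamDiagonalGluedTorusOrbits` (LH4-p08 (g2), glued strata `s = 2t ≥ 2`)
for the core-hanging frame `V_H(x, ζ, y″) = (1 0 0; x ϖ^ρ 0; xζ + y″ ϖ^ρζ ϖ^{2ρ})` with `x, ζ, y″` AND `y = xζ + y″` units (LH4-p10 (g2) MEMO v2 §4 (H), B10 socket `stub_B7_H`).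
What changes at `s = 0`: `κ := y″∕(xζ)` is a UNIT (not small) and the extra stratum letter `|xζ + y″| = 1` reads `|1 + κ| = 1` (`κ ≢ −1 (𝔭)`); the class representative `f` must
therefore satisfy `|1 + f| = 1` instead of `|f| < 1`; everything else is ★ (iv-a) at `t = 0` BY NAME.
* §1 `v_one_add_kappa_eq_one` (`|1 + κ| = 1` from the stratum letters), `v_one_add_eq_one_of_near` (`|κ − f| < 1 ⇒ |1 + f| = 1`).
* §2 `latt_coreHanging_eq_latt_coreHanging_rep` — `|κ − f| ≤ |ϖ|^ρ`, `|1 + f| = 1` ⇒ `latt V_H(x, ζ, y″) = latt V_H(x, ζ′, f·xζ′)`, `ζ′ = ζ(1 + κ)∕(1 + f)`;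
  **`exists_mem_unitTorus_latt_coreHanging_eq_mapGL`** — every such lattice lies in `𝒯·latt V_H(1, 1, f)`; `exists_coreHanging_of_mem_orbit` — conversely (with the unit letters).
* §3 **`isDualisableLattice_latt_coreHanging_iff_exists_fixed_kappa`** — over ★ B7 (i): dualisable ↔ `∃ f, σ f = f ∧ |κ − f| ≤ |ϖ|^ρ`.
* §4 `v_kappa_sub_le_of_latt_coreHanging_eq` — `κ` mod `𝔭^ρ` is a lattice invariant (★ (iv-a) at `t = 0`).
HONEST LABEL.  Count-neutral; the census laws stay PROVER TARGETS until the MS assembly lands; `HC_CM` is proved only modulo the 7 printed citations (2 remaining named inputs: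
hLiu418 = `stmt-HodgeConjecture-24832`, h413 = `stmt-HodgeConjecture-24833`) until rung 0 closes.

## References
* [Kottwitz1986BaseChangeUnits] R. Kottwitz, *Base change for unit elements of Hecke algebras*, Compositio Math. 60 (1986), §1 pp. 240–241 (lattice counts via torus orbits).
* [Serre1980Trees] J.-P. Serre, *Trees*, Springer (1980), Ch. II §1.1 (lattices `g·𝒪^N`, Hermite normal forms).
* [Jacobowitz1962] R. Jacobowitz, *Hermitian forms over local fields*, Amer. J. Math. 84 (1962), §7 (unimodular lattices).
-/

set_option autoImplicit false

noncomputable section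

namespace Summit.HodgeConjecture.HodgeConjecture.Cruxes.H413.F0P3cDyRamDiagonalCoreHangingOrbits

open Matrix
open Literature.NumberTheory.Automorphic Literature.NumberTheory.Automorphic.HermitianLattice
open Literature.NumberTheory.Automorphic.UnitaryLatticeTree
open Summit.HodgeConjecture.HodgeConjecture.Cruxes.H413.F0P3cDyRamDiagonalTorusDefs
open Summit.HodgeConjecture.HodgeConjecture.Cruxes.H413.F0P3cDyRamDiagonalGluedTorusOrbits
open scoped Valued WithZero Matrix MatrixGroups

variable {K : Type*} [Field K] [Valued K ℤᵐ⁰]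

/-! ## §1 The unit letters of the core-hanging stratum in `κ`-currency -/

/-- `|1 + y″∕(xζ)| = 1` when `x, ζ` and `xζ + y″` are units (`1 + κ = (xζ + y″)∕(xζ)`). [cite: Kottwitz1986BaseChangeUnits, §1 pp. 240–241] -/
theorem v_one_add_kappa_eq_one {x ζ y'' : K} (hx : Valued.v x = 1) (hζ : Valued.v ζ = 1) (hy : Valued.v (x * ζ + y'') = 1) :
    Valued.v (1 + y'' / (x * ζ)) = 1 := by
  have hx0 : x ≠ 0 := fun h0 => by rw [h0, map_zero] at hx; exact zero_ne_one hx
  have hζ0 : ζ ≠ 0 := fun h0 => by rw [h0, map_zero] at hζ; exact zero_ne_one hζ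
  have e : 1 + y'' / (x * ζ) = (x * ζ + y'') / (x * ζ) := by field_simp
  rw [e, map_div₀, hy, map_mul, hx, hζ, mul_one, div_one]

/-- If `|1 + κ| = 1` and `|κ − f| < 1` then `|1 + f| = 1` (ultrametric). [cite: Serre1980Trees, Ch. II §1.1] -/
theorem v_one_add_eq_one_of_near {κ f : K} (h1κ : Valued.v (1 + κ) = 1) (hκf : Valued.v (κ - f) < 1) : Valued.v (1 + f) = 1 := by
  have e : 1 + f = (1 + κ) + -(κ - f) := by ring
  rw [e, Valuation.map_add_eq_of_lt_left _ (by rwa [Valuation.map_neg, h1κ]), h1κ]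

/-- `|ϖ|^ρ < 1` for `ϖ` of valuation `< 1` and `ρ ≥ 1`. [cite: Serre1980Trees, Ch. II §1.1] -/
theorem v_pow_lt_one {ϖ : K} (hϖ1 : Valued.v ϖ < 1) {ρ : ℕ} (hρ : 1 ≤ ρ) : Valued.v ϖ ^ ρ < 1 :=
  pow_lt_one₀ zero_le hϖ1 (by omega)

/-! ## §2 Representatives with `κ = f` exactly; the orbit of `latt V_H(1, 1, f)` -/

/-- **EVERY CLASS `κ ≡ f (mod 𝔭^ρ)` HAS A REPRESENTATIVE WITH `κ = f`** (core-hanging, `s = 0`): for `x, ζ` units and `f` with `|1 + f| = 1`, `|y″∕(xζ) − f| ≤ |ϖ|^ρ`, put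
`ζ′ := ζ·(1 + y″∕(xζ))∕(1 + f)`; then `latt V_H(x, ζ, y″) = latt V_H(x, ζ′, f·(xζ′))` (same first column; `ϖ^ρ(ζ − ζ′) = ϖ^ρ ζ(f − κ)∕(1+f) ∈ 𝔭^{2ρ}`; ★ p855304).
[cite: Kottwitz1986BaseChangeUnits, §1 pp. 240–241] [cite: Serre1980Trees, Ch. II §1.1] -/
theorem latt_coreHanging_eq_latt_coreHanging_rep {ϖ : K} (hϖ : ϖ ≠ 0) (ρ : ℕ) {x ζ y'' f : K} (hx : Valued.v x = 1) (hζ : Valued.v ζ = 1) (h1f : Valued.v (1 + f) = 1)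
    (hκ : Valued.v (y'' / (x * ζ) - f) ≤ Valued.v ϖ ^ ρ) :
    latt (!![1, 0, 0; x, ϖ ^ ρ, 0; x * ζ + y'', ϖ ^ ρ * ζ, ϖ ^ (2 * ρ)] : Matrix (Fin 3) (Fin 3) K) =
      latt (!![1, 0, 0; x, ϖ ^ ρ, 0; x * (ζ * (1 + y'' / (x * ζ)) / (1 + f)) + f * (x * (ζ * (1 + y'' / (x * ζ)) / (1 + f))),
        ϖ ^ ρ * (ζ * (1 + y'' / (x * ζ)) / (1 + f)), ϖ ^ (2 * ρ)] : Matrix (Fin 3) (Fin 3) K) := by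
  have hpρ : ϖ ^ ρ ≠ 0 := pow_ne_zero ρ hϖ
  have hpr : ϖ ^ (2 * ρ) ≠ 0 := pow_ne_zero _ hϖ
  have hx0 : x ≠ 0 := fun h0 => by rw [h0, map_zero] at hx; exact zero_ne_one hx
  have hζ0 : ζ ≠ 0 := fun h0 => by rw [h0, map_zero] at hζ; exact zero_ne_one hζ
  have h1f0 : 1 + f ≠ 0 := fun h0 => by rw [h0, map_zero] at h1f; exact zero_ne_one h1f
  rw [F0P3cDyRamDiagonalStableLatticeHNFExists.latt_hnf_eq_latt_hnf_iff _ _ _ _ _ _ hpρ hpr]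
  refine ⟨by rw [sub_self, map_zero]; exact zero_le, ?_, ?_⟩
  · have hdiff : ϖ ^ ρ * ζ - ϖ ^ ρ * (ζ * (1 + y'' / (x * ζ)) / (1 + f)) = ϖ ^ ρ * (ζ * (f - y'' / (x * ζ)) / (1 + f)) := by
      field_simp
      ring
    rw [hdiff, map_mul, map_div₀, map_mul, h1f, div_one, map_pow, map_pow, hζ, one_mul, Valuation.map_sub_swap, two_mul, pow_add]
    exact mul_le_mul' le_rfl hκ
  · have hcol : x * ζ + y'' - (x * (ζ * (1 + y'' / (x * ζ)) / (1 + f)) + f * (x * (ζ * (1 + y'' / (x * ζ)) / (1 + f)))) = 0 := by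
      field_simp
      ring
    rw [hcol, sub_self, zero_mul, mul_zero, sub_zero, map_zero]
    exact zero_le

/-- **EVERY CORE-HANGING LATTICE OF THE CLASS `κ ≡ f` LIES IN THE ORBIT `𝒯·latt V_H(1, 1, f)`** (`x, ζ, xζ + y″` units, `|1 + f| = 1`, `|κ − f| ≤ |ϖ|^ρ`).
[cite: Kottwitz1986BaseChangeUnits, §1 pp. 240–241] [cite: Serre1980Trees, Ch. II §1.1] -/
theorem exists_mem_unitTorus_latt_coreHanging_eq_mapGL {ϖ : K} (hϖ : ϖ ≠ 0) (ρ : ℕ) {x ζ y'' f : K} (hx : Valued.v x = 1) (hζ : Valued.v ζ = 1)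
    (hy : Valued.v (x * ζ + y'') = 1) (h1f : Valued.v (1 + f) = 1) (hκ : Valued.v (y'' / (x * ζ) - f) ≤ Valued.v ϖ ^ ρ) (V₀ : GL (Fin 3) K)
    (hV₀ : (V₀ : Matrix (Fin 3) (Fin 3) K) = !![1, 0, 0; 1, ϖ ^ ρ, 0; 1 * 1 + f, ϖ ^ ρ * 1, ϖ ^ (2 * ρ)]) :
    ∃ u ∈ unitTorus K 3,
      latt (!![1, 0, 0; x, ϖ ^ ρ, 0; x * ζ + y'', ϖ ^ ρ * ζ, ϖ ^ (2 * ρ)] : Matrix (Fin 3) (Fin 3) K) = mapGL (diagGLUnits u) (latt (V₀ : Matrix (Fin 3) (Fin 3) K)) := by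
  have h1κ : Valued.v (1 + y'' / (x * ζ)) = 1 := v_one_add_kappa_eq_one hx hζ hy
  have hζ' : Valued.v (ζ * (1 + y'' / (x * ζ)) / (1 + f)) = 1 := by rw [map_div₀, map_mul, hζ, h1κ, h1f, one_mul, div_one]
  obtain ⟨u, hu, h⟩ := latt_glued_kappa_eq_mapGL hx hζ' f (ϖ ^ ρ) (ϖ ^ (2 * ρ)) V₀ hV₀
  exact ⟨u, hu, (latt_coreHanging_eq_latt_coreHanging_rep hϖ ρ hx hζ h1f hκ).trans h⟩

/-- **CONVERSELY every member of the orbit `𝒯·latt V_H(1, 1, f)` is a core-hanging lattice with `κ = f` EXACTLY** and, when `|f| = |1 + f| = 1`, with all four unit letters.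
[cite: Kottwitz1986BaseChangeUnits, §1 pp. 240–241] -/
theorem exists_coreHanging_of_mem_orbit (u : Fin 3 → Kˣ) (hu : u ∈ unitTorus K 3) {f : K} (hf : Valued.v f = 1) (h1f : Valued.v (1 + f) = 1) (p r : K)
    (V₀ : GL (Fin 3) K) (hV₀ : (V₀ : Matrix (Fin 3) (Fin 3) K) = !![1, 0, 0; 1, p, 0; 1 * 1 + f, p * 1, r]) :
    ∃ x' ζ' y₁ : K, Valued.v x' = 1 ∧ Valued.v ζ' = 1 ∧ Valued.v y₁ = 1 ∧ Valued.v (x' * ζ' + y₁) = 1 ∧ y₁ / (x' * ζ') = f ∧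
      mapGL (diagGLUnits u) (latt (V₀ : Matrix (Fin 3) (Fin 3) K)) = latt (!![1, 0, 0; x', p, 0; x' * ζ' + y₁, p * ζ', r] : Matrix (Fin 3) (Fin 3) K) := by
  obtain ⟨x', ζ', y₁, hx', hζ', hy₁, hκ, h⟩ := exists_glued_of_mem_orbit u hu f p r V₀ hV₀
  have hx0 : x' ≠ 0 := fun h0 => by rw [h0, map_zero] at hx'; exact zero_ne_one hx'
  have hζ0 : ζ' ≠ 0 := fun h0 => by rw [h0, map_zero] at hζ'; exact zero_ne_one hζ'
  have hy : x' * ζ' + y₁ = x' * ζ' * (1 + f) := by rw [← hκ]; field_simp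
  refine ⟨x', ζ', y₁, hx', hζ', by rw [hy₁, hf], ?_, hκ, h⟩
  rw [hy, map_mul, map_mul, hx', hζ', h1f, one_mul, one_mul]

/-! ## §3 Dualisability = `F`-rationality of the class of `κ` (over ★ B7 (i)) -/

/-- **(R) IN `κ`-CURRENCY AT `s = 0`**: under the hypotheses of ★ B7 (i) `isDualisableLattice_latt_hnf_coreHanging_iff` (involution `σ` with `v ∘ σ = v`, the wild trace bound,
`ρ ≥ 1`, the four unit letters), `latt V_H(x, ζ, y″)` is DUALISABLE iff the class of `κ = y″∕(xζ)` modulo `𝔭^ρ` contains a `σ`-fixed element: `∃ f, σ f = f ∧ |κ − f| ≤ |ϖ|^ρ`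
(`f′ := f∕(ζσζ)` ∕ `f := f′·ζσζ` as in ★ (iv-a) §4). [cite: Jacobowitz1962, §7] [cite: Kottwitz1986BaseChangeUnits, §1 pp. 240–241] -/
theorem isDualisableLattice_latt_coreHanging_iff_exists_fixed_kappa {σ : K →+* K} (hσ : ∀ a, σ (σ a) = a) (hvσ : ∀ a, Valued.v (σ a) = Valued.v a)
    {ϖ : K} (hϖ0 : ϖ ≠ 0) (hϖ1 : Valued.v ϖ < 1) (hTr : ∀ a : K, Valued.v (a + σ a) ≤ Valued.v ϖ * Valued.v a)
    (ρ : ℕ) (hρ : 1 ≤ ρ) {x ζ y'' : K} (hx : Valued.v x = 1) (hζ : Valued.v ζ = 1) (hy'' : Valued.v y'' = 1) (hy : Valued.v (x * ζ + y'') = 1)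
    (V : GL (Fin 3) K) (hV : (V : Matrix (Fin 3) (Fin 3) K) = !![1, 0, 0; x, ϖ ^ ρ, 0; x * ζ + y'', ϖ ^ ρ * ζ, ϖ ^ (2 * ρ)]) :
    IsDualisableLattice σ ϖ (latt (V : Matrix (Fin 3) (Fin 3) K)) ↔ ∃ f : K, σ f = f ∧ Valued.v (y'' / (x * ζ) - f) ≤ Valued.v ϖ ^ ρ := by
  rw [F0P3cDyRamDiagonalCoreHangingCriterion.isDualisableLattice_latt_hnf_coreHanging_iff hσ hvσ hϖ0 hϖ1 hTr ρ hρ hx hζ hy'' hy V hV]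
  have hx0 : x ≠ 0 := fun h0 => by rw [h0, map_zero] at hx; exact zero_ne_one hx
  have hζ0 : ζ ≠ 0 := fun h0 => by rw [h0, map_zero] at hζ; exact zero_ne_one hζ
  have hσζ0 : σ ζ ≠ 0 := fun h0 => hζ0 (by rw [← hσ ζ, h0, map_zero])
  have hσζ : Valued.v (σ ζ) = 1 := by rw [hvσ, hζ]
  have hN : σ (ζ * σ ζ) = ζ * σ ζ := by rw [map_mul, hσ, mul_comm]
  constructor
  · rintro ⟨f, hf, hR⟩
    refine ⟨f / (ζ * σ ζ), by rw [map_div₀, hf, hN], ?_⟩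
    have hid : y'' / (x * ζ) - f / (ζ * σ ζ) = σ (ζ * σ y'' - σ x * f) / (x * ζ * σ ζ) := by
      rw [map_sub, map_mul, map_mul, hσ, hσ, hf]
      field_simp
    rw [hid, map_div₀, hvσ, map_mul, map_mul, hx, hζ, hσζ, one_mul, one_mul, div_one]
    exact hR
  · rintro ⟨f, hf, hκ⟩
    refine ⟨f * (ζ * σ ζ), by rw [map_mul, hf, hN], ?_⟩
    have hid : ζ * σ y'' - σ x * (f * (ζ * σ ζ)) = σ (x * ζ * σ ζ * (y'' / (x * ζ) - f)) := by
      rw [map_mul, map_sub, map_mul, map_mul, hσ, hf, map_div₀, map_mul]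
      have hσx0 : σ x ≠ 0 := fun h0 => hx0 (by rw [← hσ x, h0, map_zero])
      field_simp
    rw [hid, hvσ, map_mul, map_mul, map_mul, hx, hζ, hσζ, one_mul, one_mul, one_mul]
    exact hκ

/-- Dualisable core-hanging lattices have an `F`-RATIONAL, ADMISSIBLE class: the fixed `f` of §3 is a unit with `|1 + f| = 1` (as `|κ| = |1 + κ| = 1` and `|κ − f| ≤ |ϖ|^ρ < 1`).
[cite: Kottwitz1986BaseChangeUnits, §1 pp. 240–241] -/
theorem fixed_kappa_unit_letters {ϖ : K} (hϖ1 : Valued.v ϖ < 1) {ρ : ℕ} (hρ : 1 ≤ ρ) {x ζ y'' f : K} (hx : Valued.v x = 1) (hζ : Valued.v ζ = 1)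
    (hy'' : Valued.v y'' = 1) (hy : Valued.v (x * ζ + y'') = 1) (hκ : Valued.v (y'' / (x * ζ) - f) ≤ Valued.v ϖ ^ ρ) :
    Valued.v f = 1 ∧ Valued.v (1 + f) = 1 := by
  have hlt : Valued.v (y'' / (x * ζ) - f) < 1 := hκ.trans_lt (v_pow_lt_one hϖ1 hρ)
  have hκ1 : Valued.v (y'' / (x * ζ)) = 1 := by rw [map_div₀, map_mul, hx, hζ, hy'', mul_one, div_one]
  refine ⟨?_, v_one_add_eq_one_of_near (v_one_add_kappa_eq_one hx hζ hy) hlt⟩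
  have e : f = y'' / (x * ζ) + -(y'' / (x * ζ) - f) := by ring
  rw [e, Valuation.map_add_eq_of_lt_left _ (by rwa [Valuation.map_neg, hκ1]), hκ1]

/-! ## §4 `κ` modulo `𝔭^ρ` is a lattice invariant (★ (iv-a) at `t = 0`) -/

/-- **`κ` IS A LATTICE INVARIANT modulo `𝔭^ρ`** on the core-hanging frames: equal lattices ⇒ `|y″∕(xζ) − y₁∕(x₁ζ₁)| ≤ |ϖ|^ρ` (★ (iv-a) `v_kappa_sub_le_of_latt_glued_eq` at `t = 0`).
[cite: Kottwitz1986BaseChangeUnits, §1 pp. 240–241] [cite: Serre1980Trees, Ch. II §1.1] -/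
theorem v_kappa_sub_le_of_latt_coreHanging_eq {ϖ : K} (hϖ : ϖ ≠ 0) (hϖ1 : Valued.v ϖ ≤ 1) (ρ : ℕ) {x ζ y'' x₁ ζ₁ y₁ : K}
    (hx : Valued.v x = 1) (hζ : Valued.v ζ = 1) (hy'' : Valued.v y'' = 1) (hx₁ : Valued.v x₁ = 1) (hζ₁ : Valued.v ζ₁ = 1)
    (h : latt (!![1, 0, 0; x, ϖ ^ ρ, 0; x * ζ + y'', ϖ ^ ρ * ζ, ϖ ^ (2 * ρ)] : Matrix (Fin 3) (Fin 3) K) =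
      latt (!![1, 0, 0; x₁, ϖ ^ ρ, 0; x₁ * ζ₁ + y₁, ϖ ^ ρ * ζ₁, ϖ ^ (2 * ρ)] : Matrix (Fin 3) (Fin 3) K)) :
    Valued.v (y'' / (x * ζ) - y₁ / (x₁ * ζ₁)) ≤ Valued.v ϖ ^ ρ := by
  have h' : latt (!![1, 0, 0; x, ϖ ^ ρ, 0; x * ζ + y'', ϖ ^ ρ * ζ, ϖ ^ (2 * ρ + 2 * 0)] : Matrix (Fin 3) (Fin 3) K) =
      latt (!![1, 0, 0; x₁, ϖ ^ ρ, 0; x₁ * ζ₁ + y₁, ϖ ^ ρ * ζ₁, ϖ ^ (2 * ρ + 2 * 0)] : Matrix (Fin 3) (Fin 3) K) := by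
    rw [Nat.mul_zero, Nat.add_zero]; exact h
  have hk := v_kappa_sub_le_of_latt_glued_eq hϖ hϖ1 ρ 0 hx hζ (by rw [Nat.mul_zero, pow_zero]; exact hy'') hx₁ hζ₁ h'
  rwa [Nat.mul_zero, Nat.add_zero] at hk

end Summit.HodgeConjecture.HodgeConjecture.Cruxes.H413.F0P3cDyRamDiagonalCoreHangingOrbits

end
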